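import Summits.QuantumFields.BalabanUV.Beta.EriceRemainderEnclosureHistoryAutonomyComparisonDefectInfiniteMemoryLinks

/-!
# EriceRemainderEnclosureHistoryAutonomyComparisonDefectInfiniteMemoryStep — (E140n, step) **INFINITE MEMORY: the K-free enclosure holds for functionals with an INFINITE fading
# history — no truncation in the hypotheses either.**  `B` isotone on `]0,γ]^ℕ` with zeroth moment `M`, floor `b`, `B ≤ β̄`, and, INSTEAD OF a profile on `Finset.range K`:
# (W) WINDOW PROFILES — for every `K`, `B u − B v ≤ Σ_{k<K} Λ_k·(1∕v_k² − 1∕u_k²)⁺` whenever `u, v` AGREE from coordinate `K` on (window grading `b₀`), with UNIFORMLY BOUNDED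
# partial age moments `Σ_{k<K} k·Λ_k ≤ θ < 1`, `Σ_{k<K} Λ_k·k(k+1)∕2 ≤ θ₂`; (T) FADING TAILS — `|B u − B v| ≤ η_K` whenever `u, v` agree on the first `K` coordinates, `η_K → 0`.
# `B′` ANY functional with `|B′ − B| ≤ ε` (`0 ≤ ε`, `0 < b₀`, `b₀ + ε < b`); `h₋, h₊, h′` box solutions of `B − ε, B + ε, B′` from one pin.  Then at EVERY `j`
#     **`1∕h₋_j² − c₂ ≤ 1∕h′_j² ≤ 1∕h₊_j² + c₂`,   `c₂ = θ₂·(2ε + θ·2ε∕(1−θ)) = θ₂·2ε∕(1−θ)`**   (`enclosure_infinite`).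
# PROOF: for each `K` the TRUNCATION `B_K u = B(u_0, …, u_{K−1}, p, p, …)` is a finite-memory structured functional ((E140m)), `|B − B_K| ≤ η_K` by (T), so `h′` is an orbit of a
# functional `(ε + η_K)`-close to `B_K` and (E140l) `enclosure_second` encloses it between the orbits of `B_K ∓ (ε + η_K)` up to `c₂(ε + η_K)`; the same theorem with
# remainder `η_K` ties the orbits of `B ∓ ε` to those of `B_K ∓ ε ± η_K`, and (E140m) `const_shift_levels` ties `B_K − ε − η_K` to `B_K − ε + η_K` within `2jη_K`; so for every
# `K`: `1∕h′_j² ≥ 1∕h₋_j² − 2jη_K − c₂(η_K) − c₂(ε + η_K)`.  Let `K → ∞` at fixed `j` (`η_K → 0`, `c₂` continuous, `c₂(0) = 0`): `le_of_tendsto`.  This closes census item (δ)∕(δ′)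
# «K = ∞» of `HOME/b2b-balaban-beta-d4-p2/g107/README.md` §4 for the enclosure: no tsum is needed — uniformly bounded partial moments and vanishing tails suffice.

Cell `pub-balaban`, β-function sub-cell, BINDER row D4 «RemainderConst leaves for Bałaban's split» (`HOME/BINDER-OWNERS.md`; owner lineage `b2b-balaban-beta-an4`;
this file by co-owner #2 lineage `b2b-balaban-beta-d4-p2`, generation 108), β-FLOW TEAM duty (1), FREEZE (0) honoured (def-free; (E140m) `trunc_*` ∕ `const_shift_levels`,
(E140l) `enclosure_second`, (E39) `exists_memFlow_zm` BY NAME; nothing restated).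

HONEST FRAMING (page 1, verbatim and binding).  *"Discharging BetaPertH makes Bałaban's UV stability UNCONDITIONAL — a real constructive-QFT result; it is
NOT the continuum limit and NOT the Clay problem."*  THIS FILE DISCHARGES NOTHING OF THE KIND.  Elementary real analysis about ABSTRACT functionals on a box
]0,γ]^ℕ — hypotheses of a census, not facts: whether Bałaban's (1.22) limit functional has window profiles with bounded age moments and fading tails (node U2's
`MemoryProfile`∕`FadingMemory` TYPE of hypothesis) is NOT PRINTED ([I] p. 298; GAPS G-t4-U2-1∕-2) and NOT asserted.  Row D4 class UNCHANGED (critical-path width 0; instance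
0∕1; D4 DISCHARGE NO DATE).  NOT B12 Thm 2, NOT BetaPertH, NOT continuum YM, NOT Clay.

WHAT IS PROVED ([folklore]; 0 `def`, 0 sorry).  THIS FILE (the step): `const_mono` (the enclosure constant is monotone in the partial moments), **`step_both`** (the two-sided
estimate at one truncation level `K`).  The limit `K → ∞` (`enclosure_infinite`) is the sequel `…ComparisonDefectInfiniteMemory`.
-/

noncomputable section
open Finset Set Filter Topology

namespace Summit.QuantumFields.BalabanUV.Beta.EriceRemainderEnclosureHistoryAutonomyComparisonDefectInfiniteMemoryStep

open Literature.MathematicalPhysics.QuantumFieldTheory.Balaban1983to89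
open Literature.MathematicalPhysics.QuantumFieldTheory.Balaban1983to89.T4BetaStationary
open Literature.MathematicalPhysics.QuantumFieldTheory.Balaban1983to89.T4BetaFlowWellPosed
open Summit.QuantumFields.BalabanUV.Beta.EriceRemainderEnclosureHistoryAutonomyExistence (exists_memFlow_zm)
open Summit.QuantumFields.BalabanUV.Beta.EriceRemainderEnclosureHistoryAutonomyComparisonDefectSecondMomentEnclosure (enclosure_second)
open Summit.QuantumFields.BalabanUV.Beta.EriceRemainderEnclosureHistoryAutonomyComparisonDefectInfiniteMemoryLinks
  (trunc_box trunc_mono trunc_zm trunc_floor trunc_upper trunc_profile trunc_close const_shift_levels)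

variable {B B' : (ℕ → ℝ) → ℝ} {M γ b : ℝ} {h' hlo hup : ℕ → ℝ}

/-! ## §1 One truncation level -/

/-- The enclosure constant `S₂·(2η + S₁·2η∕(1−S₁))` is monotone in the partial moments `S₁ ≤ θ < 1`, `S₂ ≤ θ₂` (`η ≥ 0`). [folklore] -/
theorem const_mono {S₁ S₂ θ θ₂ η : ℝ} (hS₁0 : 0 ≤ S₁) (hS₁ : S₁ ≤ θ) (hθ1 : θ < 1) (hS₂0 : 0 ≤ S₂) (hS₂ : S₂ ≤ θ₂) (hη : 0 ≤ η) :
    S₂ * (2 * η + S₁ * (2 * η) / (1 - S₁)) ≤ θ₂ * (2 * η + θ * (2 * η) / (1 - θ)) := by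
  have h1S : 0 < 1 - S₁ := by linarith
  have h1θ : 0 < 1 - θ := by linarith
  have hfrac : S₁ * (2 * η) / (1 - S₁) ≤ θ * (2 * η) / (1 - θ) := by
    rw [div_le_div_iff₀ h1S h1θ]
    nlinarith [mul_nonneg hS₁0 hη, mul_nonneg (sub_nonneg.mpr hS₁) hη]
  have hA0 : 0 ≤ 2 * η + S₁ * (2 * η) / (1 - S₁) := by positivity
  have hθ₂0 : 0 ≤ θ₂ := hS₂0.trans hS₂
  calc S₂ * (2 * η + S₁ * (2 * η) / (1 - S₁)) ≤ θ₂ * (2 * η + S₁ * (2 * η) / (1 - S₁)) := mul_le_mul_of_nonneg_right hS₂ hA0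
    _ ≤ θ₂ * (2 * η + θ * (2 * η) / (1 - θ)) := mul_le_mul_of_nonneg_left (by linarith) hθ₂0

/-- **ONE TRUNCATION LEVEL, BOTH HALVES.**  At a fixed `K` with tail `η′ ≥ 0`, `b₀ + ε + η′ ≤ b`:
`1∕h₋_j² − (2jη′ + C_K(η′) + C_K(ε+η′)) ≤ 1∕h′_j² ≤ 1∕h₊_j² + (2jη′ + C_K(η′) + C_K(ε+η′))` with `C_K(x) = S₂(K)·(2x + S₁(K)·2x∕(1−S₁(K)))`, `S₁(K) = Σ_{k<K} kΛ_k`,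
`S₂(K) = Σ_{k<K}Λ_kΣ_{l<k}(l+1)` — (E140l) `enclosure_second` three times (bases `B_K`, `B_K − ε`, `B_K + ε`) and (E140m) `const_shift_levels` twice; the four
auxiliary orbits (of `B_K ∓ (ε+η′)`, `B_K − ε + η′`, `B_K + ε − η′`) exist by (E39). [folklore] -/
theorem step_both {Λ : ℕ → ℝ} {K : ℕ} {βb p ε b₀ η' : ℝ}
    (hmono : ∀ u v : ℕ → ℝ, SeqBox γ u → SeqBox γ v → (∀ i, u i ≤ v i) → B u ≤ B v)
    (hB : ∀ u u' : ℕ → ℝ, SeqBox γ u → SeqBox γ u' → ∀ D : ℝ, (∀ j, |u j - u' j| ≤ D) → |B u - B u'| ≤ M * D) (hM : 0 ≤ M)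
    (hε : 0 ≤ ε) (hb₀ : 0 < b₀) (hη'0 : 0 ≤ η') (hfit : b₀ + ε + η' ≤ b)
    (hlow : ∀ u, SeqBox γ u → b ≤ B u) (hbdd : ∀ u, SeqBox γ u → B u ≤ βb)
    (hΛ : ∀ k, 0 ≤ Λ k) (hS1 : ∑ k ∈ range K, (k : ℝ) * Λ k < 1)
    (hwin : ∀ u v : ℕ → ℝ, SeqBox γ u → SeqBox γ v → (∀ k, k < K → 1 / γ ^ 2 + ((k : ℝ) + 1) * b₀ ≤ 1 / u k ^ 2) →
      (∀ k, k < K → 1 / γ ^ 2 + ((k : ℝ) + 1) * b₀ ≤ 1 / v k ^ 2) → (∀ k, K ≤ k → u k = v k) →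
      B u - B v ≤ ∑ k ∈ range K, Λ k * max (1 / v k ^ 2 - 1 / u k ^ 2) 0)
    (htail : ∀ u v : ℕ → ℝ, SeqBox γ u → SeqBox γ v → (∀ k, k < K → u k = v k) → |B u - B v| ≤ η')
    (hpert : ∀ u, SeqBox γ u → |B' u - B u| ≤ ε)
    (hp : 0 < p) (hpγ : p ≤ γ) (hhlo : SeqBox γ hlo) (hflo : MemFlow (fun w => B w + -ε) p hlo)
    (hhup : SeqBox γ hup) (hfup : MemFlow (fun w => B w + ε) p hup)
    (hh' : SeqBox γ h') (hf' : MemFlow B' p h') (j : ℕ) :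
    1 / hlo j ^ 2 - (2 * (j : ℝ) * η'
        + (∑ k ∈ range K, Λ k * ∑ l ∈ range k, ((l : ℝ) + 1))
            * (2 * η' + (∑ k ∈ range K, (k : ℝ) * Λ k) * (2 * η') / (1 - ∑ k ∈ range K, (k : ℝ) * Λ k))
        + (∑ k ∈ range K, Λ k * ∑ l ∈ range k, ((l : ℝ) + 1))
            * (2 * (ε + η') + (∑ k ∈ range K, (k : ℝ) * Λ k) * (2 * (ε + η')) / (1 - ∑ k ∈ range K, (k : ℝ) * Λ k)))
      ≤ 1 / h' j ^ 2
    ∧ 1 / h' j ^ 2 ≤ 1 / hup j ^ 2 + (2 * (j : ℝ) * η'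
        + (∑ k ∈ range K, Λ k * ∑ l ∈ range k, ((l : ℝ) + 1))
            * (2 * η' + (∑ k ∈ range K, (k : ℝ) * Λ k) * (2 * η') / (1 - ∑ k ∈ range K, (k : ℝ) * Λ k))
        + (∑ k ∈ range K, Λ k * ∑ l ∈ range k, ((l : ℝ) + 1))
            * (2 * (ε + η') + (∑ k ∈ range K, (k : ℝ) * Λ k) * (2 * (ε + η')) / (1 - ∑ k ∈ range K, (k : ℝ) * Λ k))) := by
  -- the truncation B_K and its structure
  have hKmono := trunc_mono (B := B) (K := K) hp hpγ hmono
  have hKzm := trunc_zm (B := B) (K := K) hp hpγ hB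
  have hKlow := trunc_floor (B := B) (K := K) hp hpγ hlow
  have hKbdd := trunc_upper (B := B) (K := K) hp hpγ hbdd
  have hKprof := trunc_profile (B := B) (K := K) hp hpγ hwin
  have hKclose := trunc_close (B := B) (K := K) hp hpγ htail
  -- (I) h′ is an orbit of a functional (ε+η′)-close to B_K: enclosure_second with base B_K, floor parameter b₀ + ε + η′
  have hpert1 : ∀ u, SeqBox γ u → |B' u - (fun w : ℕ → ℝ => B (fun i => if i < K then w i else p)) u| ≤ ε + η' := by
    intro u hu
    have h1 := hpert u hu
    have h2 := hKclose u hu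
    have := abs_sub_le (B' u) (B u) ((fun w : ℕ → ℝ => B (fun i => if i < K then w i else p)) u)
    rw [abs_sub_comm (B u)] at this
    linarith
  have hlow1 : ∀ u, SeqBox γ u → b₀ + (ε + η') ≤ (fun w : ℕ → ℝ => B (fun i => if i < K then w i else p)) u :=
    fun u hu => by linarith [hKlow u hu]
  have hgr1 : b₀ + (ε + η') - (ε + η') = b₀ := by ring
  -- solutions of B_K ∓ (ε+η′)
  have hεη : 0 ≤ ε + η' := by linarith
  obtain ⟨g₁, hg₁b, hg₁f⟩ := exists_memFlow_zm (B := fun w => (fun w : ℕ → ℝ => B (fun i => if i < K then w i else p)) w + -(ε + η'))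
    (M := M) (b := b₀) (γ := γ)
    (fun u u' hu hu' D hD => by
      have := hKzm u u' hu hu' D hD
      rwa [show (fun w : ℕ → ℝ => B (fun i => if i < K then w i else p)) u + -(ε + η')
          - ((fun w : ℕ → ℝ => B (fun i => if i < K then w i else p)) u' + -(ε + η'))
          = (fun w : ℕ → ℝ => B (fun i => if i < K then w i else p)) u - (fun w : ℕ → ℝ => B (fun i => if i < K then w i else p)) u' by ring])
    hM hp hpγ hb₀ (fun u hu => by linarith [hKlow u hu])
  obtain ⟨g₂, hg₂b, hg₂f⟩ := exists_memFlow_zm (B := fun w => (fun w : ℕ → ℝ => B (fun i => if i < K then w i else p)) w + (ε + η'))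
    (M := M) (b := b₀) (γ := γ)
    (fun u u' hu hu' D hD => by
      have := hKzm u u' hu hu' D hD
      rwa [show (fun w : ℕ → ℝ => B (fun i => if i < K then w i else p)) u + (ε + η')
          - ((fun w : ℕ → ℝ => B (fun i => if i < K then w i else p)) u' + (ε + η'))
          = (fun w : ℕ → ℝ => B (fun i => if i < K then w i else p)) u - (fun w : ℕ → ℝ => B (fun i => if i < K then w i else p)) u' by ring])
    hM hp hpγ hb₀ (fun u hu => by linarith [hKlow u hu])
  have hI := enclosure_second (B := fun w : ℕ → ℝ => B (fun i => if i < K then w i else p)) (B' := B')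
    hKmono hKzm hM hεη (by linarith : ε + η' < b₀ + (ε + η')) hlow1 hKbdd hΛ hS1 (by rw [hgr1]; exact hKprof) hpert1 hp hpγ
    hg₁b hg₁f hg₂b hg₂f hh' hf' j
  -- (II) h₋ is an orbit of B − ε, η′-close to the structured B_K − ε: enclosure_second with base B_K − ε, floor parameter b₀ + η′
  have hKεmono : ∀ u v : ℕ → ℝ, SeqBox γ u → SeqBox γ v → (∀ i, u i ≤ v i) →
      (fun w => (fun w : ℕ → ℝ => B (fun i => if i < K then w i else p)) w + -ε) u
        ≤ (fun w => (fun w : ℕ → ℝ => B (fun i => if i < K then w i else p)) w + -ε) v :=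
    fun u v hu hv huv => by have := hKmono u v hu hv huv; show _ + -ε ≤ _ + -ε; linarith
  have hKεzm : ∀ u u' : ℕ → ℝ, SeqBox γ u → SeqBox γ u' → ∀ D : ℝ, (∀ j, |u j - u' j| ≤ D) →
      |(fun w => (fun w : ℕ → ℝ => B (fun i => if i < K then w i else p)) w + -ε) u
        - (fun w => (fun w : ℕ → ℝ => B (fun i => if i < K then w i else p)) w + -ε) u'| ≤ M * D :=
    fun u u' hu hu' D hD => by
      have := hKzm u u' hu hu' D hD
      rwa [show (fun w : ℕ → ℝ => B (fun i => if i < K then w i else p)) u + -ε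
          - ((fun w : ℕ → ℝ => B (fun i => if i < K then w i else p)) u' + -ε)
          = (fun w : ℕ → ℝ => B (fun i => if i < K then w i else p)) u - (fun w : ℕ → ℝ => B (fun i => if i < K then w i else p)) u' by ring]
  have hKεlow : ∀ u, SeqBox γ u → b₀ + η' ≤ (fun w => (fun w : ℕ → ℝ => B (fun i => if i < K then w i else p)) w + -ε) u :=
    fun u hu => by have := hKlow u hu; show b₀ + η' ≤ _ + -ε; linarith
  have hKεbdd : ∀ u, SeqBox γ u → (fun w => (fun w : ℕ → ℝ => B (fun i => if i < K then w i else p)) w + -ε) u ≤ βb :=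
    fun u hu => by have := hKbdd u hu; show _ + -ε ≤ βb; linarith
  have hKεprof : ∀ u v : ℕ → ℝ, SeqBox γ u → SeqBox γ v → (∀ k : ℕ, 1 / γ ^ 2 + ((k : ℝ) + 1) * (b₀ + η' - η') ≤ 1 / u k ^ 2) →
      (∀ k : ℕ, 1 / γ ^ 2 + ((k : ℝ) + 1) * (b₀ + η' - η') ≤ 1 / v k ^ 2) →
      (fun w => (fun w : ℕ → ℝ => B (fun i => if i < K then w i else p)) w + -ε) u
        - (fun w => (fun w : ℕ → ℝ => B (fun i => if i < K then w i else p)) w + -ε) v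
        ≤ ∑ k ∈ range K, Λ k * max (1 / v k ^ 2 - 1 / u k ^ 2) 0 := by
    intro u v hu hv hgu hgv
    rw [show b₀ + η' - η' = b₀ by ring] at hgu hgv
    have := hKprof u v hu hv hgu hgv
    show _ + -ε - (_ + -ε) ≤ _
    linarith
  have hpert2 : ∀ u, SeqBox γ u → |(fun w => B w + -ε) u - (fun w => (fun w : ℕ → ℝ => B (fun i => if i < K then w i else p)) w + -ε) u| ≤ η' := by
    intro u hu
    have := hKclose u hu
    show |B u + -ε - (_ + -ε)| ≤ η'
    rw [show B u + -ε - ((fun w : ℕ → ℝ => B (fun i => if i < K then w i else p)) u + -ε)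
      = -((fun w : ℕ → ℝ => B (fun i => if i < K then w i else p)) u - B u) by ring, abs_neg]
    exact this
  -- solutions of (B_K − ε) ∓ η′: g₁ solves B_K − ε − η′ (same functional, rewritten), g₄ solves B_K − ε + η′
  have hg₁f2 : MemFlow (fun w => (fun w => (fun w : ℕ → ℝ => B (fun i => if i < K then w i else p)) w + -ε) w + -η') p g₁ := by
    refine ⟨hg₁f.1, fun m => ?_⟩
    rw [hg₁f.2 m]
    show _ + (_ + -(ε + η')) = _ + (_ + -ε + -η')
    ring
  obtain ⟨g₄, hg₄b, hg₄f⟩ := exists_memFlow_zm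
    (B := fun w => (fun w => (fun w : ℕ → ℝ => B (fun i => if i < K then w i else p)) w + -ε) w + η') (M := M) (b := b₀) (γ := γ)
    (fun u u' hu hu' D hD => by
      have := hKzm u u' hu hu' D hD
      rwa [show (fun w : ℕ → ℝ => B (fun i => if i < K then w i else p)) u + -ε + η'
          - ((fun w : ℕ → ℝ => B (fun i => if i < K then w i else p)) u' + -ε + η')
          = (fun w : ℕ → ℝ => B (fun i => if i < K then w i else p)) u - (fun w : ℕ → ℝ => B (fun i => if i < K then w i else p)) u' by ring])
    hM hp hpγ hb₀ (fun u hu => by have := hKlow u hu; show b₀ ≤ _ + -ε + η'; linarith)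
  have hII := (enclosure_second (B := fun w => (fun w : ℕ → ℝ => B (fun i => if i < K then w i else p)) w + -ε) (B' := fun w => B w + -ε)
    hKεmono hKεzm hM hη'0 (by linarith : η' < b₀ + η') hKεlow hKεbdd hΛ hS1 hKεprof hpert2 hp hpγ
    hg₁b hg₁f2 hg₄b hg₄f hhlo hflo j).2
  -- (III) constant shift 2η′ over the structured B_K − ε − η′: levels of g₄ ≤ levels of g₁ + 2jη′
  have h3mono : ∀ u v : ℕ → ℝ, SeqBox γ u → SeqBox γ v → (∀ i, u i ≤ v i) →
      (fun w => (fun w => (fun w : ℕ → ℝ => B (fun i => if i < K then w i else p)) w + -ε) w + -η') u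
        ≤ (fun w => (fun w => (fun w : ℕ → ℝ => B (fun i => if i < K then w i else p)) w + -ε) w + -η') v :=
    fun u v hu hv huv => by have := hKmono u v hu hv huv; show _ + -ε + -η' ≤ _ + -ε + -η'; linarith
  have h3zm : ∀ u u' : ℕ → ℝ, SeqBox γ u → SeqBox γ u' → ∀ D : ℝ, (∀ j, |u j - u' j| ≤ D) →
      |(fun w => (fun w => (fun w : ℕ → ℝ => B (fun i => if i < K then w i else p)) w + -ε) w + -η') u
        - (fun w => (fun w => (fun w : ℕ → ℝ => B (fun i => if i < K then w i else p)) w + -ε) w + -η') u'| ≤ M * D :=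
    fun u u' hu hu' D hD => by
      have := hKzm u u' hu hu' D hD
      rwa [show (fun w : ℕ → ℝ => B (fun i => if i < K then w i else p)) u + -ε + -η'
          - ((fun w : ℕ → ℝ => B (fun i => if i < K then w i else p)) u' + -ε + -η')
          = (fun w : ℕ → ℝ => B (fun i => if i < K then w i else p)) u - (fun w : ℕ → ℝ => B (fun i => if i < K then w i else p)) u' by ring]
  have h3low : ∀ u, SeqBox γ u → b₀ ≤ (fun w => (fun w => (fun w : ℕ → ℝ => B (fun i => if i < K then w i else p)) w + -ε) w + -η') u :=
    fun u hu => by have := hKlow u hu; show b₀ ≤ _ + -ε + -η'; linarith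
  have h3bdd : ∀ u, SeqBox γ u → (fun w => (fun w => (fun w : ℕ → ℝ => B (fun i => if i < K then w i else p)) w + -ε) w + -η') u ≤ βb :=
    fun u hu => by have := hKbdd u hu; show _ + -ε + -η' ≤ βb; linarith [hε]
  have h3prof : ∀ u v : ℕ → ℝ, SeqBox γ u → SeqBox γ v → (∀ k : ℕ, 1 / γ ^ 2 + ((k : ℝ) + 1) * b₀ ≤ 1 / u k ^ 2) →
      (∀ k : ℕ, 1 / γ ^ 2 + ((k : ℝ) + 1) * b₀ ≤ 1 / v k ^ 2) →
      (fun w => (fun w => (fun w : ℕ → ℝ => B (fun i => if i < K then w i else p)) w + -ε) w + -η') u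
        - (fun w => (fun w => (fun w : ℕ → ℝ => B (fun i => if i < K then w i else p)) w + -ε) w + -η') v
        ≤ ∑ k ∈ range K, Λ k * max (1 / v k ^ 2 - 1 / u k ^ 2) 0 := by
    intro u v hu hv hgu hgv
    have := hKprof u v hu hv hgu hgv
    show _ + -ε + -η' - (_ + -ε + -η') ≤ _
    linarith
  have hg₄f' : MemFlow (fun w => (fun w => (fun w => (fun w : ℕ → ℝ => B (fun i => if i < K then w i else p)) w + -ε) w + -η') w + 2 * η') p g₄ := by
    refine ⟨hg₄f.1, fun m => ?_⟩
    rw [hg₄f.2 m]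
    show _ + (_ + -ε + η') = _ + (_ + -ε + -η' + 2 * η')
    ring
  have hIII := (const_shift_levels (B := fun w => (fun w => (fun w : ℕ → ℝ => B (fun i => if i < K then w i else p)) w + -ε) w + -η')
    h3mono h3zm hM hb₀ h3low h3bdd hΛ hS1.le h3prof (by linarith : (0 : ℝ) ≤ 2 * η') hp hpγ hg₁b hg₁f2 hg₄b hg₄f' j).2
  -- (II′) h₊ is an orbit of B + ε, η′-close to the structured B_K + ε: enclosure_second with base B_K + ε, floor parameter b₀ + η′
  have hKpmono : ∀ u v : ℕ → ℝ, SeqBox γ u → SeqBox γ v → (∀ i, u i ≤ v i) →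
      (fun w => (fun w : ℕ → ℝ => B (fun i => if i < K then w i else p)) w + ε) u
        ≤ (fun w => (fun w : ℕ → ℝ => B (fun i => if i < K then w i else p)) w + ε) v :=
    fun u v hu hv huv => by have := hKmono u v hu hv huv; show _ + ε ≤ _ + ε; linarith
  have hKpzm : ∀ u u' : ℕ → ℝ, SeqBox γ u → SeqBox γ u' → ∀ D : ℝ, (∀ j, |u j - u' j| ≤ D) →
      |(fun w => (fun w : ℕ → ℝ => B (fun i => if i < K then w i else p)) w + ε) u
        - (fun w => (fun w : ℕ → ℝ => B (fun i => if i < K then w i else p)) w + ε) u'| ≤ M * D :=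
    fun u u' hu hu' D hD => by
      have := hKzm u u' hu hu' D hD
      rwa [show (fun w : ℕ → ℝ => B (fun i => if i < K then w i else p)) u + ε
          - ((fun w : ℕ → ℝ => B (fun i => if i < K then w i else p)) u' + ε)
          = (fun w : ℕ → ℝ => B (fun i => if i < K then w i else p)) u - (fun w : ℕ → ℝ => B (fun i => if i < K then w i else p)) u' by ring]
  have hKplow : ∀ u, SeqBox γ u → b₀ + η' ≤ (fun w => (fun w : ℕ → ℝ => B (fun i => if i < K then w i else p)) w + ε) u :=
    fun u hu => by have := hKlow u hu; show b₀ + η' ≤ _ + ε; linarith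
  have hKpbdd : ∀ u, SeqBox γ u → (fun w => (fun w : ℕ → ℝ => B (fun i => if i < K then w i else p)) w + ε) u ≤ βb + ε :=
    fun u hu => by have := hKbdd u hu; show _ + ε ≤ βb + ε; linarith
  have hKpprof : ∀ u v : ℕ → ℝ, SeqBox γ u → SeqBox γ v → (∀ k : ℕ, 1 / γ ^ 2 + ((k : ℝ) + 1) * (b₀ + η' - η') ≤ 1 / u k ^ 2) →
      (∀ k : ℕ, 1 / γ ^ 2 + ((k : ℝ) + 1) * (b₀ + η' - η') ≤ 1 / v k ^ 2) →
      (fun w => (fun w : ℕ → ℝ => B (fun i => if i < K then w i else p)) w + ε) u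
        - (fun w => (fun w : ℕ → ℝ => B (fun i => if i < K then w i else p)) w + ε) v
        ≤ ∑ k ∈ range K, Λ k * max (1 / v k ^ 2 - 1 / u k ^ 2) 0 := by
    intro u v hu hv hgu hgv
    rw [show b₀ + η' - η' = b₀ by ring] at hgu hgv
    have := hKprof u v hu hv hgu hgv
    show _ + ε - (_ + ε) ≤ _
    linarith
  have hpert3 : ∀ u, SeqBox γ u → |(fun w => B w + ε) u - (fun w => (fun w : ℕ → ℝ => B (fun i => if i < K then w i else p)) w + ε) u| ≤ η' := by
    intro u hu
    have := hKclose u hu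
    show |B u + ε - (_ + ε)| ≤ η'
    rw [show B u + ε - ((fun w : ℕ → ℝ => B (fun i => if i < K then w i else p)) u + ε)
      = -((fun w : ℕ → ℝ => B (fun i => if i < K then w i else p)) u - B u) by ring, abs_neg]
    exact this
  -- solutions of (B_K + ε) ∓ η′: g₅ solves B_K + ε − η′, g₂ solves B_K + ε + η′ (rewritten)
  obtain ⟨g₅, hg₅b, hg₅f⟩ := exists_memFlow_zm
    (B := fun w => (fun w => (fun w : ℕ → ℝ => B (fun i => if i < K then w i else p)) w + ε) w + -η') (M := M) (b := b₀) (γ := γ)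
    (fun u u' hu hu' D hD => by
      have := hKzm u u' hu hu' D hD
      rwa [show (fun w : ℕ → ℝ => B (fun i => if i < K then w i else p)) u + ε + -η'
          - ((fun w : ℕ → ℝ => B (fun i => if i < K then w i else p)) u' + ε + -η')
          = (fun w : ℕ → ℝ => B (fun i => if i < K then w i else p)) u - (fun w : ℕ → ℝ => B (fun i => if i < K then w i else p)) u' by ring])
    hM hp hpγ hb₀ (fun u hu => by have := hKlow u hu; show b₀ ≤ _ + ε + -η'; linarith)
  have hg₂f2 : MemFlow (fun w => (fun w => (fun w : ℕ → ℝ => B (fun i => if i < K then w i else p)) w + ε) w + η') p g₂ := by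
    refine ⟨hg₂f.1, fun m => ?_⟩
    rw [hg₂f.2 m]
    show _ + (_ + (ε + η')) = _ + (_ + ε + η')
    ring
  have hII' := (enclosure_second (B := fun w => (fun w : ℕ → ℝ => B (fun i => if i < K then w i else p)) w + ε) (B' := fun w => B w + ε)
    hKpmono hKpzm hM hη'0 (by linarith : η' < b₀ + η') hKplow hKpbdd hΛ hS1 hKpprof hpert3 hp hpγ
    hg₅b hg₅f hg₂b hg₂f2 hhup hfup j).1
  -- (III′) constant shift 2η′ over the structured B_K + ε − η′: levels of g₂ ≤ levels of g₅ + 2jη′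
  have h5mono : ∀ u v : ℕ → ℝ, SeqBox γ u → SeqBox γ v → (∀ i, u i ≤ v i) →
      (fun w => (fun w => (fun w : ℕ → ℝ => B (fun i => if i < K then w i else p)) w + ε) w + -η') u
        ≤ (fun w => (fun w => (fun w : ℕ → ℝ => B (fun i => if i < K then w i else p)) w + ε) w + -η') v :=
    fun u v hu hv huv => by have := hKmono u v hu hv huv; show _ + ε + -η' ≤ _ + ε + -η'; linarith
  have h5zm : ∀ u u' : ℕ → ℝ, SeqBox γ u → SeqBox γ u' → ∀ D : ℝ, (∀ j, |u j - u' j| ≤ D) →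
      |(fun w => (fun w => (fun w : ℕ → ℝ => B (fun i => if i < K then w i else p)) w + ε) w + -η') u
        - (fun w => (fun w => (fun w : ℕ → ℝ => B (fun i => if i < K then w i else p)) w + ε) w + -η') u'| ≤ M * D :=
    fun u u' hu hu' D hD => by
      have := hKzm u u' hu hu' D hD
      rwa [show (fun w : ℕ → ℝ => B (fun i => if i < K then w i else p)) u + ε + -η'
          - ((fun w : ℕ → ℝ => B (fun i => if i < K then w i else p)) u' + ε + -η')
          = (fun w : ℕ → ℝ => B (fun i => if i < K then w i else p)) u - (fun w : ℕ → ℝ => B (fun i => if i < K then w i else p)) u' by ring]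
  have h5low : ∀ u, SeqBox γ u → b₀ ≤ (fun w => (fun w => (fun w : ℕ → ℝ => B (fun i => if i < K then w i else p)) w + ε) w + -η') u :=
    fun u hu => by have := hKlow u hu; show b₀ ≤ _ + ε + -η'; linarith
  have h5bdd : ∀ u, SeqBox γ u → (fun w => (fun w => (fun w : ℕ → ℝ => B (fun i => if i < K then w i else p)) w + ε) w + -η') u ≤ βb + ε :=
    fun u hu => by have := hKbdd u hu; show _ + ε + -η' ≤ βb + ε; linarith
  have h5prof : ∀ u v : ℕ → ℝ, SeqBox γ u → SeqBox γ v → (∀ k : ℕ, 1 / γ ^ 2 + ((k : ℝ) + 1) * b₀ ≤ 1 / u k ^ 2) →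
      (∀ k : ℕ, 1 / γ ^ 2 + ((k : ℝ) + 1) * b₀ ≤ 1 / v k ^ 2) →
      (fun w => (fun w => (fun w : ℕ → ℝ => B (fun i => if i < K then w i else p)) w + ε) w + -η') u
        - (fun w => (fun w => (fun w : ℕ → ℝ => B (fun i => if i < K then w i else p)) w + ε) w + -η') v
        ≤ ∑ k ∈ range K, Λ k * max (1 / v k ^ 2 - 1 / u k ^ 2) 0 := by
    intro u v hu hv hgu hgv
    have := hKprof u v hu hv hgu hgv
    show _ + ε + -η' - (_ + ε + -η') ≤ _
    linarith
  have hg₂f' : MemFlow (fun w => (fun w => (fun w => (fun w : ℕ → ℝ => B (fun i => if i < K then w i else p)) w + ε) w + -η') w + 2 * η') p g₂ := by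
    refine ⟨hg₂f.1, fun m => ?_⟩
    rw [hg₂f.2 m]
    show _ + (_ + (ε + η')) = _ + (_ + ε + -η' + 2 * η')
    ring
  have hIII' := (const_shift_levels (B := fun w => (fun w => (fun w : ℕ → ℝ => B (fun i => if i < K then w i else p)) w + ε) w + -η')
    h5mono h5zm hM hb₀ h5low h5bdd hΛ hS1.le h5prof (by linarith : (0 : ℝ) ≤ 2 * η') hp hpγ hg₅b hg₅f hg₂b hg₂f' j).2
  -- combine
  have e2 : (j : ℝ) * (2 * η') = 2 * (j : ℝ) * η' := by ring
  rw [e2] at hIII hIII'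
  obtain ⟨hI1, hI2⟩ := hI
  constructor
  · linarith [hI1, hII, hIII]
  · linarith [hI2, hII', hIII']

end Summit.QuantumFields.BalabanUV.Beta.EriceRemainderEnclosureHistoryAutonomyComparisonDefectInfiniteMemoryStep

end
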